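import Literature.InformationTheory.QuantumCodes.QuantumExpanderSmallSetFlipThreshold
import HarnessLib

/-!
# The small-set-flip decoder is monotone in its parameter: FGL18 Remark 9 (PROVED), Proposition 11 and
# Theorem 1 for Algorithm 1

Index of sources: `[cite: FawziGrospellierLeverrier2018]` = Fawzi–Grospellier–Leverrier, "Efficient decoding of
random errors for quantum expander codes", STOC 2018 / arXiv:1711.08351v2 (Algorithms 1–2, Remark 9, Def 10,
Prop 11, Thm 1); `[cite: LeverrierTillichZemor2015]` = Leverrier–Tillich–Zémor, FOCS 2015 / arXiv:1504.00822.

qec PARTITION v2 row 04 (`prover-qec-type-04`, gen 4). The tree types the small-set-flip decoder as a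
NONDETERMINISTIC procedure with a per-qubit flip parameter `κ` (`QuantumExpanderCodes.lean`: a valid step
`IsSSFStep κ` flips a small set `F` with positive syndrome decrease `≥ κ|F|` that MAXIMISES the ratio
decrease/`|F|`; `κ = 0` is FGL18's Algorithm 1 = LTZ15's decoder, `κ = βΔ_B` is Algorithm 2; `IsSSFRun κ` = complete
valid runs; `IsSSFDecoder κ D` = "`D` returns on every syndrome the output of some complete valid `κ`-run"). The
threshold theorem (FGL18 Thm 1) is in the tree for Algorithm 2 with `β = β₀` (`QuantumExpander.fgl18_theorem1_beta`),
and FGL18 transfer it to Algorithm 1 by their Remark 9 (arXiv v2 p0011 L1-2):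

> "The while loop condition in Algorithm 2 is stronger than in Algorithm 1 and this is the only difference between
> the two algorithms. As a consequence if Algorithm 2 corrects an error `E`, then Algorithm 1 corrects `E`."

(used on p0014 L7: "Using Remark 9, it is sufficient to prove Theorem 1 for Algorithm 2 instead of Algorithm 1").
No proof is printed. THIS FILE PROVES IT, in the tree's typing, by a PREFIX argument that rests on the one
feature the two algorithms share — the `argmax` rule: let `F₀, …, F_{f-1}` be a complete valid `κ'`-run from `σ`
and `κ' ≤ κ`; let `j` be the first index with `κ|F_j| > decrease(F_j)` (`j = f` if none). Then `F₀, …, F_{j-1}` is a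
COMPLETE valid `κ`-run from `σ` (`exists_prefix_isSSFRun`): every earlier step passes the `κ`-condition,
and at `σ_j` the flipped set `F_j` maximises the ratio and has ratio `< κ`, so EVERY small set has ratio `< κ` and the
`κ`-decoder halts (for `j = f`: halting for `κ'` implies halting for `κ ≥ κ'`). If that `κ`-run corrects the error,
its final syndrome `σ_j = σ_X(E ⊕ Ê_j)` vanishes (`H_X H_Zᵀ = 0`), no small set has positive decrease at `σ_j`, so
`j = f` (`not_isSSFStep_zero`) and the `κ'`-run has the SAME output. Consequently
(`exists_isSSFDecoder_dominating`) every `κ'`-decoder `D` is dominated by a `κ`-decoder `D'` — `D'` corrects `E` ⇒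
`D` corrects `E` — which is Remark 9 for decoders (`corrects_of_le`, `QuantumExpander.fgl18_remark9`) and carries
failure-probability bounds from parameter `κ` down to every `κ' ≤ κ` (`exists_dominating_sum_le`).

Consequences for quantum expander codes (`(Δ_A, Δ_B)`-biregular, `1 ≤ Δ_A ≤ Δ_B`, `(γ_A, δ_A, γ_B, δ_B)`-expanding,
`β₀ > 0`): Prop 11's adversarial radius `(rβ₀/(1+β₀)) min(γ_A n_A, γ_B n_B)` holds for EVERY parameter
`κ ≤ β₀Δ_B`, in particular for Algorithm 1 (`fgl18_proposition11_of_le`); Theorem 1 holds for every `κ ≤ β₀Δ_B`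
with the constants of `fgl18_theorem1_beta` (`fgl18_theorem1_of_le`); and the typed named fact
`FGL18_theorem1_le` (Algorithm 1, `κ = 0`) is DISCHARGED: `QuantumExpander.FGL18_theorem1_le_holds`.

All statements PROVED (kernel axioms); no definitions, no new named facts. Not here: the converse transfer (false: for large `κ` Algorithm 2 never flips),
running-time claims, the `Z`-sector (same statements for `Hᵀ`).
-/

namespace Literature.InformationTheory.QuantumCodes

namespace SmallSetFlip

open Finset Matrix Literature.Probability.LatticeModels

variable {Q C R : Type*} [Fintype Q] [Fintype C] [Fintype R] [DecidableEq Q]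

/-! ### The prefix argument: inside every `κ'`-run sits a complete `κ`-run, `κ' ≤ κ` -/

section Prefix

/-- A halting syndrome for parameter `κ'` is halting for every `κ ≥ κ'` (the while-condition of parameter `κ` is
stronger). [cite: FawziGrospellierLeverrier2018, Remark 9 (§3.2, arXiv v2 p0011 L1-2)] -/
theorem ssfHalts_mono {κ' κ : ℝ} (hκ : κ' ≤ κ) {Hs : Matrix C Q (ZMod 2)} {Hg : Matrix R Q (ZMod 2)}
    {σ : C → ZMod 2} (h : SSFHalts κ' Hs Hg σ) : SSFHalts κ Hs Hg σ := by
  intro F hF hcond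
  refine h F hF ⟨hcond.1, ?_⟩
  have hc : (0 : ℝ) ≤ F.card := Nat.cast_nonneg _
  exact (mul_le_mul_of_nonneg_right hκ hc).trans hcond.2

/-- If a valid step (a ratio MAXIMISER with positive decrease) fails the while-condition of parameter `κ`, then no
small set passes it: the decoder of parameter `κ` halts at this syndrome. This is where the shared `argmax` rule of
Algorithms 1 and 2 enters. [cite: FawziGrospellierLeverrier2018, Remark 9 with Algorithms 1–2 (argmax; §2.3 p0009, §3.2 p0010–p0011)] -/
theorem ssfHalts_of_isSSFStep_of_not_le {κ' κ : ℝ} {Hs : Matrix C Q (ZMod 2)} {Hg : Matrix R Q (ZMod 2)}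
    {σ : C → ZMod 2} {F : Finset Q} (hF : IsSSFStep κ' Hs Hg σ F)
    (hc : ¬ κ * F.card ≤ (syndromeDecrease Hs σ F : ℝ)) : SSFHalts κ Hs Hg σ := by
  intro F' hF' hcond
  refine hc ?_
  have hcF' : (0 : ℝ) < F'.card := by exact_mod_cast card_pos_of_mem_smallSets hF'
  have hcF : (0 : ℝ) < F.card := by exact_mod_cast card_pos_of_mem_smallSets hF.1
  have h1 : κ ≤ (syndromeDecrease Hs σ F' : ℝ) / F'.card := by
    rw [le_div_iff₀ hcF']; exact hcond.2
  have h3 : κ ≤ (syndromeDecrease Hs σ F : ℝ) / F.card := h1.trans (hF.2.2.2 F' hF')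
  rwa [le_div_iff₀ hcF] at h3

/-- No valid step from the ZERO syndrome (a step needs a positive syndrome decrease `|σ| - |σ ⊕ σ_X(F)| > 0`).
[cite: FawziGrospellierLeverrier2018, Algorithm 1 (while-condition `> 0`; §2.3, arXiv v2 p0009)] -/
theorem not_isSSFStep_zero {κ : ℝ} {Hs : Matrix C Q (ZMod 2)} {Hg : Matrix R Q (ZMod 2)} {F : Finset Q} :
    ¬ IsSSFStep κ Hs Hg 0 F := by
  intro hF
  have hdec := hF.2.1
  rw [syndromeDecrease, zero_add, hammingNorm_zero, Nat.cast_zero, zero_sub] at hdec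
  have h0 : (0 : ℤ) ≤ hammingNorm (Hs *ᵥ flipVec F) := Int.natCast_nonneg _
  omega

/-- **The prefix argument (Remark 9, run form).** Inside every complete valid run `F₀, …, F_{f-1}` of parameter `κ'`
from `σ` there is, for each `κ ≥ κ'`, a PREFIX `F₀, …, F_{j-1}` which is a complete valid run of parameter `κ` from
`σ` — keep the flips while they pass the stronger while-condition `κ|Fᵢ| ≤ decrease`; at the first rejected flip
`F_j`, a ratio maximiser with ratio `< κ`, no small set passes the `κ`-condition and the `κ`-decoder halts; if no
flip is rejected, the `κ'`-halting final syndrome is `κ`-halting — and which is the WHOLE run as soon as its own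
final syndrome `σ ⊕ σ_X(F₀ ⊕ ⋯ ⊕ F_{j-1})` vanishes (no valid step leaves the zero syndrome, so `j = f`). ("The while
loop condition in Algorithm 2 is stronger than in Algorithm 1 and this is the only difference between the two
algorithms.") [cite: FawziGrospellierLeverrier2018, Remark 9 (§3.2, arXiv v2 p0011 L1-2)] -/
theorem exists_prefix_isSSFRun {κ' κ : ℝ} (hκ : κ' ≤ κ) {Hs : Matrix C Q (ZMod 2)} {Hg : Matrix R Q (ZMod 2)}
    {σ : C → ZMod 2} {l : List (Finset Q)} (h : IsSSFRun κ' Hs Hg σ l) :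
    ∃ l₁ : List (Finset Q), l₁ <+: l ∧ IsSSFRun κ Hs Hg σ l₁ ∧
      (σ + Hs *ᵥ runOutput l₁ = 0 → l₁ = l) := by
  induction h with
  | halt hh =>
    exact ⟨[], List.nil_prefix, IsSSFRun.halt (ssfHalts_mono hκ hh), fun _ => rfl⟩
  | @step σ F l hF hrest ih =>
    obtain ⟨l₁, hpre, hrun₁, hzero⟩ := ih
    by_cases hc : κ * F.card ≤ (syndromeDecrease Hs σ F : ℝ)
    · refine ⟨F :: l₁, List.cons_prefix_cons.2 ⟨rfl, hpre⟩,
        IsSSFRun.step ⟨hF.1, hF.2.1, hc, hF.2.2.2⟩ hrun₁, fun h0 => ?_⟩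
      rw [QuantumExpander.runOutput_cons, Matrix.mulVec_add, ← add_assoc] at h0
      rw [hzero h0]
    · refine ⟨[], List.nil_prefix, IsSSFRun.halt (ssfHalts_of_isSSFStep_of_not_le hF hc), fun h0 => ?_⟩
      exfalso
      have hσ : σ = 0 := by simpa [runOutput] using h0
      rw [hσ] at hF
      exact not_isSSFStep_zero hF

end Prefix

/-! ### Remark 9 for decoders: every `κ'`-decoder is dominated by a `κ`-decoder, `κ' ≤ κ` -/

section Decoders

/-- **Domination.** For `κ' ≤ κ` and a CSS-like pair (`σ_X` vanishes on `rowsp H_Z`), every small-set-flip decoder `D`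
of parameter `κ'` admits a small-set-flip decoder `D'` of parameter `κ` — run `D`'s own run and stop at the first
flip failing the `κ`-condition — such that every error corrected by `D'` is corrected by `D` (same syndrome ⇒ the
`κ`-run ends at syndrome `0` ⇒ it is the whole `κ'`-run ⇒ same output).
[cite: FawziGrospellierLeverrier2018, Remark 9 (§3.2, arXiv v2 p0011 L1-2)] -/
theorem exists_isSSFDecoder_dominating {κ' κ : ℝ} (hκ : κ' ≤ κ) {Hs : Matrix C Q (ZMod 2)}
    {Hg : Matrix R Q (ZMod 2)} (hCSS : ∀ v ∈ rowSpace Hg, Hs *ᵥ v = 0)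
    {D : Decoder (C → ZMod 2) (Q → ZMod 2)} (hD : IsSSFDecoder κ' Hs Hg D) :
    ∃ D' : Decoder (C → ZMod 2) (Q → ZMod 2), IsSSFDecoder κ Hs Hg D' ∧
      ∀ e : Q → ZMod 2, D'.Corrects (fun x => Hs *ᵥ x) (rowSpace Hg : Set (Q → ZMod 2)) e →
        D.Corrects (fun x => Hs *ᵥ x) (rowSpace Hg : Set (Q → ZMod 2)) e := by
  choose run hrun hDrun using hD
  have hpre := fun σ => exists_prefix_isSSFRun hκ (hrun σ)
  choose pre _hprefix hrunpre hzero using hpre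
  refine ⟨fun σ => runOutput (pre σ), fun σ => ⟨_, hrunpre σ, rfl⟩, ?_⟩
  intro e hcorr
  change runOutput (pre (Hs *ᵥ e)) + e ∈ (rowSpace Hg : Set (Q → ZMod 2)) at hcorr
  change D (Hs *ᵥ e) + e ∈ (rowSpace Hg : Set (Q → ZMod 2))
  have h0 : Hs *ᵥ e + Hs *ᵥ runOutput (pre (Hs *ᵥ e)) = 0 := by
    have h := hCSS _ (SetLike.mem_coe.1 hcorr)
    rwa [Matrix.mulVec_add, add_comm] at h
  have key : D (Hs *ᵥ e) = runOutput (pre (Hs *ᵥ e)) := by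
    rw [hDrun, hzero _ h0]
  rw [key]
  exact hcorr

/-- **FGL18 Remark 9, decoder form** (generic CSS-like pair): if EVERY small-set-flip decoder of parameter `κ`
corrects `e` ("Algorithm 2 corrects `E`" — for any non-deterministic choice of the `Fᵢ`), then every small-set-flip
decoder of any parameter `κ' ≤ κ` corrects `e` (in particular Algorithm 1, `κ' = 0`).
[cite: FawziGrospellierLeverrier2018, Remark 9 (§3.2, arXiv v2 p0011 L1-2)] -/
theorem corrects_of_le {κ' κ : ℝ} (hκ : κ' ≤ κ) {Hs : Matrix C Q (ZMod 2)} {Hg : Matrix R Q (ZMod 2)}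
    (hCSS : ∀ v ∈ rowSpace Hg, Hs *ᵥ v = 0) (e : Q → ZMod 2)
    (h : ∀ D' : Decoder (C → ZMod 2) (Q → ZMod 2), IsSSFDecoder κ Hs Hg D' →
      D'.Corrects (fun x => Hs *ᵥ x) (rowSpace Hg : Set (Q → ZMod 2)) e)
    {D : Decoder (C → ZMod 2) (Q → ZMod 2)} (hD : IsSSFDecoder κ' Hs Hg D) :
    D.Corrects (fun x => Hs *ᵥ x) (rowSpace Hg : Set (Q → ZMod 2)) e := by
  obtain ⟨D', hD', hdom⟩ := exists_isSSFDecoder_dominating hκ hCSS hD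
  exact hdom e (h D' hD')

open Classical in
/-- **Failure weights are monotone in the parameter**: for `κ' ≤ κ`, a nonnegative error weight `μ`, and a
small-set-flip decoder `D` of parameter `κ'`, some small-set-flip decoder `D'` of parameter `κ` fails on a superset
of the error patterns on which `D` fails, so `μ{D fails} ≤ μ{D' fails}` — any failure bound proved for EVERY
decoder of parameter `κ` (FGL18 Thm 1 for Algorithm 2) holds for every decoder of parameter `κ' ≤ κ` (Algorithm 1).
[cite: FawziGrospellierLeverrier2018, Remark 9 and proof of Thm 1 (§3.2 p0011 L1-2, §4 p0014 L7)] -/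
theorem exists_dominating_sum_le {κ' κ : ℝ} (hκ : κ' ≤ κ) {Hs : Matrix C Q (ZMod 2)}
    {Hg : Matrix R Q (ZMod 2)} (hCSS : ∀ v ∈ rowSpace Hg, Hs *ᵥ v = 0)
    {D : Decoder (C → ZMod 2) (Q → ZMod 2)} (hD : IsSSFDecoder κ' Hs Hg D)
    {μ : Finset Q → ℝ} (hμ : ∀ E, 0 ≤ μ E) :
    ∃ D' : Decoder (C → ZMod 2) (Q → ZMod 2), IsSSFDecoder κ Hs Hg D' ∧
      (∑ E ∈ univ.filter (fun E : Finset Q =>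
          ¬ D.Corrects (fun x => Hs *ᵥ x) (rowSpace Hg : Set (Q → ZMod 2)) (flipVec E)), μ E) ≤
        ∑ E ∈ univ.filter (fun E : Finset Q =>
          ¬ D'.Corrects (fun x => Hs *ᵥ x) (rowSpace Hg : Set (Q → ZMod 2)) (flipVec E)), μ E := by
  obtain ⟨D', hD', hdom⟩ := exists_isSSFDecoder_dominating hκ hCSS hD
  refine ⟨D', hD', Finset.sum_le_sum_of_subset_of_nonneg ?_ fun E _ _ => hμ E⟩
  intro E hE
  simp only [Finset.mem_filter, Finset.mem_univ, true_and] at hE ⊢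
  exact fun hc => hE (hdom _ hc)

end Decoders

end SmallSetFlip

/-! ### Quantum expander codes: Remark 9, Proposition 11 and Theorem 1 for every parameter `κ ≤ β₀Δ_B` -/

namespace QuantumExpander

open Finset Matrix Literature.Probability.LatticeModels

section Remark9

variable {A B : Type*} [Fintype A] [Fintype B] [DecidableEq A] [DecidableEq B]

/-- **Fawzi–Grospellier–Leverrier 2018, Remark 9, PROVED** for the quantum expander code `Q_G` (`X`-sector): "The
while loop condition in Algorithm 2 is stronger than in Algorithm 1 and this is the only difference between the two
algorithms. As a consequence if Algorithm 2 corrects an error `E`, then Algorithm 1 corrects `E`." Typed: if every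
small-set-flip decoder of parameter `κ` corrects `e`, then every small-set-flip decoder of any parameter `κ' ≤ κ`
corrects `e` (`κ = βΔ_B`, `κ' = 0` is the printed remark; any tie-breaking on both sides).
[cite: FawziGrospellierLeverrier2018, Remark 9 (§3.2, arXiv v2 p0011 L1-2)] -/
theorem fgl18_remark9 (H : Matrix B A (ZMod 2)) {κ' κ : ℝ} (hκ : κ' ≤ κ)
    (e : (A × A) ⊕ (B × B) → ZMod 2)
    (h : ∀ D' : Decoder (A × B → ZMod 2) ((A × A) ⊕ (B × B) → ZMod 2),
      IsSSFDecoder κ (expanderHX H) (expanderHZ H) D' →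
      D'.Corrects (fun x => expanderHX H *ᵥ x)
        (rowSpace (expanderHZ H) : Set ((A × A) ⊕ (B × B) → ZMod 2)) e)
    {D : Decoder (A × B → ZMod 2) ((A × A) ⊕ (B × B) → ZMod 2)}
    (hD : IsSSFDecoder κ' (expanderHX H) (expanderHZ H) D) :
    D.Corrects (fun x => expanderHX H *ᵥ x)
      (rowSpace (expanderHZ H) : Set ((A × A) ⊕ (B × B) → ZMod 2)) e :=
  SmallSetFlip.corrects_of_le hκ (fun _ hv => expanderHX_mulVec_eq_zero_of_mem_rowSpace H hv) e h hD

end Remark9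

section Proposition11

variable {A B : Type} [Fintype A] [Fintype B] [DecidableEq A] [DecidableEq B]

/-- **FGL18 Proposition 11 for every parameter `κ ≤ β₀Δ_B`, in particular for Algorithm 1** (Remark 9 applied to
`FGL18_proposition11_le_holds`): for a `(Δ_A, Δ_B)`-biregular (`1 ≤ Δ_A ≤ Δ_B`) `(γ_A, δ_A, γ_B, δ_B)`-left-right-expanding
graph with `β₀ > 0`, every small-set-flip decoder of parameter `κ ≤ β₀Δ_B` (any tie-breaking; `κ = 0` = LTZ15's
decoder) corrects every `X`-error of weight `≤ (rβ₀/(1+β₀)) min(γ_A n_A, γ_B n_B)`, `r = Δ_A/Δ_B` ("if Algorithm 2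
corrects an error `E`, then Algorithm 1 corrects `E`").
[cite: FawziGrospellierLeverrier2018, Prop 11 with Remark 9 (§3.2, arXiv v2 p0011)] -/
theorem fgl18_proposition11_of_le (H : Matrix B A (ZMod 2)) {dA dB : ℕ} {γA δA γB δB : ℝ}
    (hreg : IsBiregular H dA dB) (hexp : IsLeftRightExpanding H dA dB γA δA γB δB)
    (hdA : 0 < dA) (hdB : 0 < dB) (hle : dA ≤ dB) (hγA : 0 < γA) (hδA : 0 < δA) (hγB : 0 < γB)
    (hδB : 0 < δB) (hβ : 0 < betaZero dA dB δA δB) {κ : ℝ} (hκ : κ ≤ betaZero dA dB δA δB * dB)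
    {D : Decoder (A × B → ZMod 2) ((A × A) ⊕ (B × B) → ZMod 2)}
    (hD : IsSSFDecoder κ (expanderHX H) (expanderHZ H) D) {e : (A × A) ⊕ (B × B) → ZMod 2}
    (he : (hammingNorm e : ℝ) ≤
      ((dA : ℝ) / dB) * betaZero dA dB δA δB / (1 + betaZero dA dB δA δB) *
        min (γA * Fintype.card A) (γB * Fintype.card B)) :
    D.Corrects (fun x => expanderHX H *ᵥ x)
      (rowSpace (expanderHZ H) : Set ((A × A) ⊕ (B × B) → ZMod 2)) e :=
  fgl18_remark9 H hκ e (fun D' hD' => FGL18_proposition11_le_holds A B H dA dB γA δA γB δB hreg hexp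
    hdA hdB hle hγA hδA hγB hδB hβ D' hD' e he) hD

end Proposition11

section Theorem1

open Classical in
/-- **FGL18 Theorem 1 for every parameter `κ ≤ β₀Δ_B`** (the `β₀`-version `fgl18_theorem1_beta` transported down by
Remark 9 / `SmallSetFlip.exists_dominating_sum_le`): for fixed degrees `1 ≤ Δ_A ≤ Δ_B` and expansion parameters with
`β₀ > 0` there are `p₀ > 0`, `C`, `C' > 0` (those of `fgl18_theorem1_beta`: `p₀ = (4Δ²)^{-1/α}`, `C = 2`, …) such that
for every biregular expanding `G` with these parameters, EVERY `κ ≤ β₀Δ_B`, every small-set-flip decoder of parameter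
`κ` and every locally stochastic `X`-error weight of parameter `0 ≤ p < p₀`, the total weight of the uncorrected error
patterns is `≤ C (n_A² + n_B²) (p/p₀)^{C'√(n_A² + n_B²)}`.
[cite: FawziGrospellierLeverrier2018, Thm 1 (§1, arXiv v2 p0004) with Remark 9 (p0011) and its proof (§4, p0014 L7)] -/
theorem fgl18_theorem1_of_le :
    ∀ (dA dB : ℕ) (γA δA γB δB : ℝ), 0 < dA → 0 < dB → dA ≤ dB → 0 < γA → 0 < δA → 0 < γB → 0 < δB →
      0 < betaZero dA dB δA δB →
      ∃ (p₀ C C' : ℝ), 0 < p₀ ∧ 0 < C' ∧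
        ∀ (A B : Type) [Fintype A] [Fintype B] [DecidableEq A] [DecidableEq B]
          (H : Matrix B A (ZMod 2)),
          IsBiregular H dA dB → IsLeftRightExpanding H dA dB γA δA γB δB →
          ∀ κ : ℝ, κ ≤ betaZero dA dB δA δB * dB →
          ∀ D : Decoder (A × B → ZMod 2) ((A × A) ⊕ (B × B) → ZMod 2),
            IsSSFDecoder κ (expanderHX H) (expanderHZ H) D →
            ∀ (p : ℝ) (μ : Finset ((A × A) ⊕ (B × B)) → ℝ), 0 ≤ p → p < p₀ →
              IsLocallyStochastic μ p →
              (∑ E ∈ univ.filter (fun E : Finset ((A × A) ⊕ (B × B)) =>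
                  ¬ D.Corrects (fun x => expanderHX H *ᵥ x) (rowSpace (expanderHZ H) : Set _)
                    (flipVec E)), μ E) ≤
                C * ((Fintype.card A : ℝ) ^ 2 + (Fintype.card B : ℝ) ^ 2) *
                  (p / p₀) ^ (C' * Real.sqrt ((Fintype.card A : ℝ) ^ 2 + (Fintype.card B : ℝ) ^ 2)) := by
  intro dA dB γA δA γB δB hdA hdB hle hγA hδA hγB hδB hβ
  obtain ⟨p₀, C, C', hp₀, hC', hmain⟩ :=
    fgl18_theorem1_beta dA dB γA δA γB δB hdA hdB hle hγA hδA hγB hδB hβ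
  refine ⟨p₀, C, C', hp₀, hC', ?_⟩
  intro A B _ _ _ _ H hreg hexp κ hκ D hD p μ hp0 hpp₀ hμ
  obtain ⟨D', hD', hsum⟩ := SmallSetFlip.exists_dominating_sum_le hκ
    (fun _ hv => expanderHX_mulVec_eq_zero_of_mem_rowSpace H hv) hD (fun E => hμ.nonneg E)
  exact hsum.trans (hmain A B H hreg hexp D' hD' p μ hp0 hpp₀ hμ)

/-- **Fawzi–Grospellier–Leverrier 2018, Theorem 1, PROVED as typed — discharges the named fact `FGL18_theorem1_le`**
(the threshold of the small-set-flip decoder, Algorithm 1 / `κ = 0`, under local stochastic noise, `X`-sector, with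
the convention `Δ_A ≤ Δ_B`): "there exists a probability `p₀ > 0` and constants `C, C'` such that if the noise
parameter satisfies `p < p₀`, the small-set-flip decoding algorithm corrects a random error with probability at least
`1 - Cn(p/p₀)^{C'√n}`". Proof = the printed route, now complete in the tree: Theorem 1 for Algorithm 2 with `β = β₀`
(`fgl18_theorem1_beta`: Props 11, 12, 15, Thm 17) and the transfer to Algorithm 1 ("Using Remark 9, it is sufficient
to prove Theorem 1 for Algorithm 2 instead of Algorithm 1"), Remark 9 being proved above.
[cite: FawziGrospellierLeverrier2018, Thm 1 (§1, arXiv v2 p0004) and its proof (§4, p0014 L7; Remark 9, p0011 L1-2)] -/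
theorem FGL18_theorem1_le_holds : FGL18_theorem1_le := by
  intro dA dB γA δA γB δB hdA hdB hle hγA hδA hγB hδB hβ
  obtain ⟨p₀, C, C', hp₀, hC', hmain⟩ :=
    fgl18_theorem1_of_le dA dB γA δA γB δB hdA hdB hle hγA hδA hγB hδB hβ
  refine ⟨p₀, C, C', hp₀, hC', ?_⟩
  intro A B _ _ _ _ H hreg hexp D hD p μ hp0 hpp₀ hμ
  have hκ : (0 : ℝ) ≤ betaZero dA dB δA δB * dB := mul_nonneg hβ.le (Nat.cast_nonneg _)
  exact hmain A B H hreg hexp 0 hκ D hD p μ hp0 hpp₀ hμ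

end Theorem1

end QuantumExpander

end Literature.InformationTheory.QuantumCodes
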